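import Mathlib
import Summits.ResolutionOfSingularities.ResolutionOfSingularities.Theorems.RadicialJungCleanModelsCleanProp44NearLineSchemeSide
import HarnessLib

/-!
# Route `RadicialJung`, crux `CleanModels` (stmt-ResolutionOfSingularities-15917), line `Sketch` rev 35, stub 6 `stub_cleanProp44` (X44c):
# CLEAN-PERMISSIBILITY OF NEAR LINES, V — corners: two clean sides through the point, the curve an axis (scheme level)

Seat decomp-res-hand-2 g18 (structural hand); sequel of `…CleanProp44NearLineScheme{,Side}.lean` (same setting: `τ : X' → X` a blowing up along
`J`, the line of `G` clean-permissible at `x = τ x'` for `J_x` in form (1) with `b = 0`, `dim 𝒪_{X',x'} = 3`, `N = (e', z)` a regular curve germ of the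
exceptional divisor through `x'`, `(e') = J_x 𝒪_{X',x'}`).

* `IsRsopPart.natCast_le_ringKrullDim_of_isRsopPart`, `IsRsopPart.span_range_eq_maximalIdeal_of_ringKrullDim_eq` — bookkeeping: a part of a regular system of
  parameters has at most `dim` members, and spans `𝔪` when it has exactly `dim` members.
* `side_trichotomy` — a parameter `s ∈ 𝔪 = (e', z, z')` is TRANSVERSAL to `N = (e', z)` (`(e', z, s) = 𝔪`), or lies in `N + 𝔪²` (then it is IN `N`
  or TANGENT to `N`).
* `cleanPermissibleAt_exceptionalCurve_of_two_sides` — TWO clean sides `V(c_{k₁})`, `V(c_{k₂})` through `x'` (a corner of the clean divisor on the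
  exceptional divisor) and `N` IS ONE OF THEM (`s₁ ∈ N`): clean-permissible as soon as one of `Σ a_k`, `a_{k₁}`, `a_{k₂}` is prime to `p`
  (✓ `cleanPermissibleAt_exceptional_of_two_sides`; the non-axis directions through a corner are NOT clean-permissible,
  ✓ `not_cleanPermissibleAt_diagonal_cornerWitness`).

Honest framing: OURS; a TOOL for the (R1ᵐⁱⁿ)/(R3ᵐⁱⁿ′) provers.  Nothing here proves X44c, any case of `CleanModels`, or resolution of
singularities in characteristic `p`.  Setting only: [cite: Piltant2013, §2 Axiom 4] [cite: CossartPiltant2008, Lemma 4.3 (5)]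
[cite: Matsumura1987, Thm. 14.2].
-/

noncomputable section

set_option linter.dupNamespace false -- mandated namespace of this single-conjunct summit

open IsLocalRing CategoryTheory AlgebraicGeometry
open Literature.AlgebraicGeometry.Resolution Literature.AlgebraicGeometry.Motives

namespace Summit.ResolutionOfSingularities.ResolutionOfSingularities.Theorems.RadicialJung.CleanModels

universe u

/-! ## §0 Bookkeeping on parts of regular systems of parameters -/

/-- A part of a regular system of parameters has at most `dim R` members. [cite: Matsumura1987, Thm. 14.2] -/
theorem _root_.Literature.AlgebraicGeometry.Resolution.IsRsopPart.natCast_le_ringKrullDim_of_isRsopPart {R : Type u} [CommRing R] [IsLocalRing R] {N : ℕ} {z : Fin N → R} (hz : IsRsopPart z) :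
    (N : WithBot ℕ∞) ≤ ringKrullDim R := by
  obtain ⟨-, e, -, hdim, -⟩ := hz
  rw [hdim]
  exact_mod_cast Nat.le_add_right N e

/-- A part of a regular system of parameters with exactly `dim R` members spans `𝔪`. [cite: Matsumura1987, Thm. 14.2] -/
theorem _root_.Literature.AlgebraicGeometry.Resolution.IsRsopPart.span_range_eq_maximalIdeal_of_ringKrullDim_eq {R : Type u} [CommRing R] [IsLocalRing R] {N : ℕ} {z : Fin N → R}
    (hz : IsRsopPart z) (hdim : ringKrullDim R = (N : WithBot ℕ∞)) : Ideal.span (Set.range z) = maximalIdeal R := by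
  obtain ⟨-, e, y, hdim', hspan⟩ := hz
  rw [hdim] at hdim'
  have he : e = 0 := by
    have h1 : (N : ℕ) = N + e := by exact_mod_cast hdim'
    omega
  subst he
  have hy : Set.range y = ∅ := Set.range_eq_empty _
  rwa [hy, Set.union_empty] at hspan

/-- **Trichotomy of a side against the curve.**  In a local ring with `𝔪 = (e', z, z')`, every `s ∈ 𝔪` is either TRANSVERSAL to `N = (e', z)`
(`(e', z, s) = 𝔪`) or lies in `N + 𝔪²` (and then either in `N` — the side IS the curve — or tangent to it). [folklore] -/
theorem side_trichotomy {R : Type u} [CommRing R] [IsLocalRing R] {e' z z' s : R} (hzz : Ideal.span ({e', z, z'} : Set R) = maximalIdeal R)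
    (hs : s ∈ maximalIdeal R) :
    Ideal.span ({e', z, s} : Set R) = maximalIdeal R ∨ s ∈ Ideal.span ({e', z} : Set R) ⊔ maximalIdeal R ^ 2 := by
  have he'm : e' ∈ maximalIdeal R := hzz ▸ Ideal.subset_span (by simp)
  have hzm : z ∈ maximalIdeal R := hzz ▸ Ideal.subset_span (by simp)
  have hz'm : z' ∈ maximalIdeal R := hzz ▸ Ideal.subset_span (by simp)
  rw [← hzz, Ideal.mem_span_insert] at hs
  obtain ⟨α, y, hy, hsy⟩ := hs
  rw [Ideal.mem_span_insert] at hy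
  obtain ⟨β, y', hy', hyy⟩ := hy
  obtain ⟨γ, rfl⟩ := Ideal.mem_span_singleton'.mp hy'
  by_cases hγ : IsUnit γ
  · left
    obtain ⟨g, rfl⟩ := hγ
    have hsm : s ∈ maximalIdeal R := by
      rw [hsy, hyy]
      exact Ideal.add_mem _ (Ideal.mul_mem_left _ _ he'm) (Ideal.add_mem _ (Ideal.mul_mem_left _ _ hzm) (Ideal.mul_mem_left _ _ hz'm))
    have hz' : z' = ↑g⁻¹ * (s - α * e' - β * z) := by
      rw [hsy, hyy]
      have h1 : α * e' + (β * z + ↑g * z') - α * e' - β * z = ↑g * z' := by ring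
      rw [h1, ← mul_assoc, Units.inv_mul, one_mul]
    apply le_antisymm
    · rw [Ideal.span_le, Set.insert_subset_iff, Set.insert_subset_iff, Set.singleton_subset_iff]
      exact ⟨he'm, hzm, hsm⟩
    · rw [← hzz, Ideal.span_le, Set.insert_subset_iff, Set.insert_subset_iff, Set.singleton_subset_iff]
      refine ⟨Ideal.subset_span (by simp), Ideal.subset_span (by simp), ?_⟩
      rw [SetLike.mem_coe, hz']
      exact Ideal.mul_mem_left _ _ (Ideal.sub_mem _ (Ideal.sub_mem _ (Ideal.subset_span (by simp))
        (Ideal.mul_mem_left _ _ (Ideal.subset_span (by simp)))) (Ideal.mul_mem_left _ _ (Ideal.subset_span (by simp))))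
  · right
    rw [hsy, hyy, ← add_assoc]
    refine Ideal.add_mem _ (Ideal.mem_sup_left (Ideal.add_mem _ (Ideal.mul_mem_left _ _ (Ideal.subset_span (by simp)))
      (Ideal.mul_mem_left _ _ (Ideal.subset_span (by simp))))) (Ideal.mem_sup_right ?_)
    rw [pow_two]
    exact Ideal.mul_mem_mul ((mem_maximalIdeal _).mpr hγ) hz'm

/-! ## §1 Two clean sides through the point, the curve an axis -/

section Scheme

variable {p : ℕ} {X X' : Scheme.{u}} [IsIntegral X] [IsIntegral X'] {τ : X' ⟶ X} [IsDominant τ]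
  {J : X.IdealSheafData}

/-- **A corner of the clean divisor, `N` an axis**: two clean sides `V(c_{k₁}) ≠ V(c_{k₂})` pass through `x'` (`τ^♯ c_{k_j} = e' · s_j`, `s_j ∈ 𝔪`), no
third one does, and `N = (e', z)` CONTAINS `s₁` (is the axis `(e', s₁)`); if one of `Σ a_k`, `a_{k₁}`, `a_{k₂}` is prime to `p`, then `N` is
clean-permissible (`(e', s₁, s₂)` is a regular system of parameters of the `3`-dimensional `𝒪_{X',x'}`, transform `U · e'^A · s₁^{a₁} · s₂^{a₂}`).
[cite: Piltant2013, §2 Axiom 4] [cite: CossartPiltant2008, Lemma 4.3 (5)] -/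
theorem cleanPermissibleAt_exceptionalCurve_of_two_sides [Fact p.Prime] (hτ : IsBlowup τ J) (x' : X')
    (hR : IsRegularLocalRing (X.presheaf.stalk (τ x'))) {n l : ℕ} (c : Fin n → X.presheaf.stalk (τ x'))
    (w : Fin l → X.presheaf.stalk (τ x')) (hz : Ideal.span (Set.range (Fin.append c w)) = maximalIdeal (X.presheaf.stalk (τ x')))
    (hdim : ringKrullDim (X.presheaf.stalk (τ x')) = ((n + l : ℕ) : WithBot ℕ∞))
    (hcJ : Ideal.span (Set.range c) = stalkIdeal J (τ x'))
    {G : X.functionField} {cc : Fin p → X.functionField} (hcc : ∃ j : Fin p, (j : ℕ) ≠ 0 ∧ cc j ≠ 0)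
    {u : X.presheaf.stalk (τ x')} (hu : IsUnit u) {a : Fin n → ℕ} {b : Fin l → ℕ}
    (hrep : (∑ j : Fin p, cc j ^ p * G ^ (j : ℕ)) = RatFn.toFunctionField (τ x') (u * (∏ k, c k ^ a k) * ∏ m, w m ^ b m))
    (hb : ∀ m, b m = 0) {k₁ k₂ : Fin n} (hk : k₁ ≠ k₂)
    (hothers : ∀ k, k ≠ k₁ → k ≠ k₂ → a k ≠ 0 → Ideal.span {(τ.stalkMap x').hom (c k)} = (stalkIdeal J (τ x')).map (τ.stalkMap x').hom)
    (hexp : ¬ p ∣ ∑ k, a k ∨ ¬ p ∣ a k₁ ∨ ¬ p ∣ a k₂)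
    (hdim' : ringKrullDim (X'.presheaf.stalk x') = 3) {e' z s₁ s₂ : X'.presheaf.stalk x'}
    (he' : Ideal.span {e'} = (stalkIdeal J (τ x')).map (τ.stalkMap x').hom)
    (he'm : e' ∈ maximalIdeal (X'.presheaf.stalk x')) (hzm : z ∈ maximalIdeal (X'.presheaf.stalk x'))
    (hs₁ : (τ.stalkMap x').hom (c k₁) = e' * s₁) (hs₂ : (τ.stalkMap x').hom (c k₂) = e' * s₂)
    (hs₁m : s₁ ∈ maximalIdeal (X'.presheaf.stalk x')) (hs₂m : s₂ ∈ maximalIdeal (X'.presheaf.stalk x'))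
    (hs₁N : s₁ ∈ Ideal.span ({e', z} : Set (X'.presheaf.stalk x'))) :
    CleanPermissibleAt p (RatFn.toFunctionField x') (RatFn.functionFieldMap τ G) (Ideal.span ({e', z} : Set (X'.presheaf.stalk x'))) := by
  classical
  obtain ⟨i, uf, m, jJ, hrel, -, hjJ, hch, hcomplete, hrsop, U, hU, -, heq⟩ :=
    exists_transform_normalForm_of_isBlowup hτ x' hR c w hz hdim hcJ a b hu
  have hR' : IsRegularLocalRing (X'.presheaf.stalk x') := hrsop.isRegularLocalRing
  haveI := isDomain_of_isRegularLocalRing (X'.presheaf.stalk x')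
  have hei : (τ.stalkMap x').hom (c i) ≠ 0 := by simpa using hrsop.ne_zero 0
  have hE : Ideal.span {(τ.stalkMap x').hom (c i)} = (stalkIdeal J (τ x')).map (τ.stalkMap x').hom := by
    rw [← hcJ]; exact span_singleton_eq_map_span_of_rel _ c i uf hrel
  obtain ⟨v, hv⟩ : Associated e' ((τ.stalkMap x').hom (c i)) := Ideal.span_singleton_eq_span_singleton.mp (he'.trans hE.symm)
  have he'0 : e' ≠ 0 := left_ne_zero_of_mul (hv.symm ▸ hei)
  -- both sides are charged: `k_j ≠ i`, `uf_{k_j} = v⁻¹ s_j ∈ 𝔪`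
  have key : ∀ {k : Fin n} {s : X'.presheaf.stalk x'}, (τ.stalkMap x').hom (c k) = e' * s → s ∈ maximalIdeal (X'.presheaf.stalk x') →
      uf k = ↑v⁻¹ * s ∧ uf k ∈ maximalIdeal (X'.presheaf.stalk x') ∧ k ≠ i := by
    intro k s hs hsm
    have hvuf : ↑v * uf k = s := by
      apply mul_left_cancel₀ he'0
      rw [← mul_assoc, hv, ← hrel k, hs]
    have huf : uf k = ↑v⁻¹ * s := by rw [← hvuf, ← mul_assoc, Units.inv_mul, one_mul]
    have hufm : uf k ∈ maximalIdeal (X'.presheaf.stalk x') := by rw [huf]; exact Ideal.mul_mem_left _ _ hsm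
    refine ⟨huf, hufm, ?_⟩
    rintro rfl
    have h1 : (τ.stalkMap x').hom (c k) * uf k = (τ.stalkMap x').hom (c k) * 1 := by rw [mul_one, ← hrel]
    have h2 : uf k = 1 := mul_left_cancel₀ hei h1
    exact mem_nonunits_iff.mp ((mem_maximalIdeal _).mp hufm) (h2 ▸ isUnit_one)
  obtain ⟨huf₁, huf₁m, hk₁i⟩ := key hs₁ hs₁m
  obtain ⟨huf₂, huf₂m, hk₂i⟩ := key hs₂ hs₂m
  obtain ⟨q₁, hq₁⟩ := hcomplete k₁ hk₁i huf₁m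
  obtain ⟨q₂, hq₂⟩ := hcomplete k₂ hk₂i huf₂m
  have hq : q₁ ≠ q₂ := fun h => hk (by rw [← hq₁, ← hq₂, h])
  -- no other charged side carries an exponent
  have ha0 : ∀ q, q ≠ q₁ → q ≠ q₂ → a (jJ q).1 = 0 := by
    intro q h₁ h₂
    by_contra hne
    have hk₁' : (jJ q).1 ≠ k₁ := fun h => h₁ (hjJ (Subtype.ext (h.trans hq₁.symm)))
    have hk₂' : (jJ q).1 ≠ k₂ := fun h => h₂ (hjJ (Subtype.ext (h.trans hq₂.symm)))
    have hspan := hothers _ hk₁' hk₂' hne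
    rw [← hE, hrel] at hspan
    exact mem_nonunits_iff.mp ((mem_maximalIdeal _).mp (hch q)) (isUnit_of_span_singleton_mul_eq hei hspan)
  have hprod1 : ∏ q, uf (jJ q).1 ^ a (jJ q).1 = uf k₁ ^ a k₁ * uf k₂ ^ a k₂ := by
    rw [Finset.prod_eq_mul q₁ q₂ hq (fun q _ h => by rw [ha0 q h.1 h.2, pow_zero]) (fun h => absurd (Finset.mem_univ _) h)
      (fun h => absurd (Finset.mem_univ _) h), hq₁, hq₂]
  have hprod2 : ∏ m', (τ.stalkMap x').hom (w m') ^ b m' = 1 := Finset.prod_eq_one fun m' _ => by rw [hb m', pow_zero]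
  have heq' : (τ.stalkMap x').hom (u * (∏ k, c k ^ a k) * ∏ m', w m' ^ b m') =
      (U * ↑v ^ (∑ k, a k) * ↑v⁻¹ ^ a k₁ * ↑v⁻¹ ^ a k₂) * e' ^ (∑ k, a k) * s₁ ^ a k₁ * s₂ ^ a k₂ := by
    rw [heq, hprod1, hprod2, mul_one, huf₁, huf₂, ← hv, mul_pow, mul_pow, mul_pow]; ring
  have hunit : IsUnit (U * ↑v ^ (∑ k, a k) * ↑v⁻¹ ^ a k₁ * ↑v⁻¹ ^ a k₂) :=
    ((hU.mul ((Units.isUnit v).pow _)).mul ((Units.isUnit v⁻¹).pow _)).mul ((Units.isUnit v⁻¹).pow _)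
  obtain ⟨hcc', hrep'⟩ := rep_functionFieldMap x' hcc hrep
  rw [heq'] at hrep'
  -- `(e', s₁, s₂)` is a regular system of parameters of `𝒪_{X',x'}`
  have htriple : IsRsopPart ![e', s₁, s₂] := by
    have hinj : Function.Injective (![0, Fin.succ (Fin.castAdd l q₁), Fin.succ (Fin.castAdd l q₂)] : Fin 3 → Fin (m + l + 1)) := by
      have hne12 : Fin.succ (Fin.castAdd l q₁) ≠ Fin.succ (Fin.castAdd l q₂) := fun h =>
        hq (Fin.castAdd_injective _ _ (Fin.succ_injective _ h))
      intro t₁ t₂ h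
      fin_cases t₁ <;> fin_cases t₂
      all_goals (first | rfl | (exfalso; simp only [Fin.zero_eta, Fin.mk_one, Fin.reduceFinMk, Matrix.cons_val_zero, Matrix.cons_val_one,
        Matrix.cons_val_two, Matrix.tail_cons, Matrix.head_cons] at h; first
          | exact Fin.succ_ne_zero _ h | exact Fin.succ_ne_zero _ h.symm | exact hne12 h | exact hne12 h.symm))
    have h1 := hrsop.comp _ hinj
    have h2 : (Fin.cons ((τ.stalkMap x').hom (c i)) (Fin.append (fun q => uf (jJ q).1) fun m' => (τ.stalkMap x').hom (w m')) :
        Fin (m + l + 1) → X'.presheaf.stalk x') ∘ (![0, Fin.succ (Fin.castAdd l q₁), Fin.succ (Fin.castAdd l q₂)] : Fin 3 → Fin (m + l + 1)) =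
        ![(τ.stalkMap x').hom (c i), uf k₁, uf k₂] := by
      funext t
      fin_cases t
      · rfl
      · simp only [Function.comp_apply, Fin.mk_one, Matrix.cons_val_one, Matrix.cons_val_zero, Fin.cons_succ, Fin.append_left, hq₁]
      · simp only [Function.comp_apply, Fin.reduceFinMk, Matrix.cons_val, Fin.cons_succ, Fin.append_left, hq₂]
    rw [h2] at h1
    refine h1.of_associated fun t => ?_
    fin_cases t
    · change Associated ((τ.stalkMap x').hom (c i)) e'
      exact ⟨v⁻¹, by rw [← hv, mul_assoc, Units.mul_inv, mul_one]⟩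
    · change Associated (uf k₁) s₁
      exact ⟨v, by rw [huf₁, mul_comm, ← mul_assoc, Units.mul_inv, one_mul]⟩
    · change Associated (uf k₂) s₂
      exact ⟨v, by rw [huf₂, mul_comm, ← mul_assoc, Units.mul_inv, one_mul]⟩
  have h𝔪 : Ideal.span ({e', s₁, s₂} : Set (X'.presheaf.stalk x')) = maximalIdeal (X'.presheaf.stalk x') := by
    have hr : Set.range ![e', s₁, s₂] = {e', s₁, s₂} := by
      ext t
      simp only [Set.mem_range, Set.mem_insert_iff, Set.mem_singleton_iff]
      constructor
      · rintro ⟨j, rfl⟩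
        fin_cases j <;> simp
      · rintro (rfl | rfl | rfl)
        exacts [⟨0, rfl⟩, ⟨1, rfl⟩, ⟨2, rfl⟩]
    rw [← hr]
    exact IsRsopPart.span_range_eq_maximalIdeal_of_ringKrullDim_eq htriple (by rw [hdim']; norm_cast)
  -- `s₁ ∈ N` with `(e', s₁)` part of an rsp: `N = (e', s₁)`
  have hpair : IsRsopPart (Fin.append ![e'] ![s₁]) := by
    have hinj : Function.Injective (![0, 1] : Fin 2 → Fin 3) := by decide
    have h1 := htriple.comp _ hinj
    have h2 : (![e', s₁, s₂] : Fin 3 → X'.presheaf.stalk x') ∘ (![0, 1] : Fin 2 → Fin 3) = Fin.append ![e'] ![s₁] := by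
      funext t; fin_cases t <;> rfl
    rwa [h2] at h1
  obtain ⟨α, β, hαβ⟩ := Ideal.mem_span_pair.mp hs₁N
  have hβ : IsUnit β := by
    by_contra hβ
    apply append_right_not_mem_span_sup_sq hpair 0
    have hr : Set.range ![e'] = {e'} := by
      ext t; simp
    simp only [Matrix.cons_val_fin_one, hr]
    rw [← hαβ]
    refine Ideal.add_mem _ (Ideal.mem_sup_left (Ideal.mul_mem_left _ _ (Ideal.mem_span_singleton_self _))) (Ideal.mem_sup_right ?_)
    rw [pow_two]
    exact Ideal.mul_mem_mul ((mem_maximalIdeal _).mpr hβ) hzm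
  have hs' : s₁ = β * z + α * e' := by rw [← hαβ, add_comm]
  have hN : Ideal.span ({e', s₁} : Set (X'.presheaf.stalk x')) = Ideal.span {e', z} := by
    rw [Ideal.span_pair_comm, nearLine_span_pair_eq_of_isUnit hβ hs', Ideal.span_pair_comm]
  rw [← hN]
  exact cleanPermissibleAt_exceptional_of_two_sides (RatFn.toFunctionField x') hR' hdim' h𝔪 _ hcc' hunit hexp hrep'

end Scheme

end Summit.ResolutionOfSingularities.ResolutionOfSingularities.Theorems.RadicialJung.CleanModels

end
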